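import Summits.BirchSwinnertonDyer.BirchSwinnertonDyer.Theorems.UniversalToricDescentThinCombRigidity
import HarnessLib

/-!
# Sketch (planner `bsd-wall-utd-idea` g42) — crux idea `stable-fibre-regulator` on
# `AdditiveSplitIMCInclusionAtThree` (item stmt-BirchSwinnertonDyer-20395), line `thin_comb`, stub `stub_twoVarCombSupply` (K2(b))

EVIDENCE ONLY (cell `pub/bsd-wall`); nothing here is a route item, nothing about elliptic curves is asserted, BSD is
not proved by any of this.

THE IDEA (card `idea-stable-fibre-regulator.md`). The research half K2(b) of `stub_twoVarCombSupply` is a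
`𝛉`-dominant explicit reciprocity law for the Beilinson–Flach class of `(f_E ⊗ ε_m, 𝛉^{(𝔭)})` along the `𝔭`-axis of
the Dirichlet twist `f_E ⊗ ε_m` (= the comb line `T₂ = ζ_m − 1`), at the SUPERCUSPIDAL prime `3 ∣ N`. The card computes
it IN THE STABLE FIBRE: at every WEIGHT-TWO point of the axis (CM characters of type `(1,0)` and conductor `𝔭^{n+1}`,
`n` unbounded — the points `T₁ = ζ_{3^{n+1}} − 1`) the class is motivic (pushforward of a Siegel unit along the
diagonal of `Y × Y`) and its syntomic regulator is Besser–Loeffler–Zerbes' TRIPLE SYMBOL `[η_θ^{ur}; ω_f, dlog u]` on a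
semistable model of `Y` (arXiv:1405.7527 Prop. 3.12; models of any 3-power level: Weinstein arXiv:1010.4241, `p` odd);
the unit-root class `η_θ^{ur}` of the ORDINARY CM form sees only the Igusa components (every other component of the
stable fibre is a supersingular curve `xy^q − x^qy = 1`, `y^q + y = x^{q+1}`, `y^q − y = x²`; the toric part carries
Steinberg types only), where `ω_f = dF` is EXACT (`f` supercuspidal: no Igusa eigen-piece, no annular residues), so the
symbol is Hida's ordinary-locus pairing `⟨η_θ^{ur}, e_ord(F · E_u)⟩` = the value of Hida's `𝛉`-dominant measure.
The identity at the weight-two torsion points of UNBOUNDED level then gives the `Λ`-adic law on the whole axis by the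
DENSITY LEMMA below — which is this file's checkable content: a one-variable corollary of the lead's
`eq_zero_of_thinCombDvdRat_zero` (Theorems/UniversalToricDescentThinCombRigidity.lean).

CONTENTS (kernel-checked, no `sorry`):
* §1 `TorsionCombDvdRat 𝒪 p F` — `E_m(X) = Φ_{p^{m+1}}(1+X)` divides `p^{t_m}·F` in `𝒪⟦X⟧` on levels `m` of
  unbounded order ("`F` vanishes, up to a `p`-power slack, at the primitive `p^{m+1}`-torsion points `ζ − 1`");
* §2 `eq_zero_of_torsionCombDvdRat` — such an `F` is `0` (DVR `𝒪` with maximal ideal `(p)`);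
  `eq_of_torsionCombDvdRat_sub` — two series congruent modulo `E_m` up to slack on unboundedly many levels are EQUAL
  (the form in which "reciprocity law at all weight-two points of 3-power conductor ⇒ `Λ`-adic reciprocity law" is used);
* §3 instances `ℤ_p` and `R₀ = unrIntegers p` (the coefficient ring of the wall's receptacle).

References: Washington, *Introduction to Cyclotomic Fields*, §7.1–7.2 [cite: Washington1997, §7.1–§7.2];
Besser–Loeffler–Zerbes, arXiv:1405.7527, Prop. 3.12; Kings–Loeffler–Zerbes, arXiv:1503.02888, Thm. 6.3.4 and §10
(density argument, p. 44); Weinstein, arXiv:1010.4241, Thm. 1.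
-/

set_option linter.dupNamespace false

noncomputable section

namespace Summit.BirchSwinnertonDyer.BirchSwinnertonDyer.Cruxes.AdditiveSplitIMCInclusionAtThree.StableFibreRegulator

open Summit.BirchSwinnertonDyer.BirchSwinnertonDyer.Theorems.UniversalToricDescentThinComb

variable (𝒪 : Type*) [CommRing 𝒪] [IsDomain 𝒪] [IsDiscreteValuationRing 𝒪] (p : ℕ) [hp : Fact p.Prime]

/-! ## §1 Torsion-comb divisibility in one variable -/

omit [IsDomain 𝒪] [IsDiscreteValuationRing 𝒪] hp in
/-- `E_m(X) ∣ p^{t_m}·F` in `𝒪⟦X⟧` on levels `m` of unbounded order: `F` vanishes, up to a `p`-power slack, at all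
primitive `p^{m+1}`-th-root-of-unity points `X = ζ − 1` (all Galois conjugates at once) for unboundedly many `m`. On the
`𝔭`-axis of the card these are the WEIGHT-TWO points (CM characters of type `(1,0)` and conductor `𝔭^{m+1}`).
[cite: Washington1997, §7.1] -/
def TorsionCombDvdRat (F : PowerSeries 𝒪) : Prop :=
  ∀ n : ℕ, ∃ m : ℕ, n ≤ m ∧ ∃ t : ℕ, combSeries 𝒪 p m ∣ PowerSeries.C ((p : 𝒪) ^ t) * F

/-! ## §2 Density of the weight-two torsion points -/

/-- **Density lemma.** Over a DVR `𝒪` with maximal ideal `(p)`, a power series divisible by `E_m(X)` up to a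
`p`-power slack on levels of unbounded order is `0`. One-variable corollary of the lead's two-variable
`eq_zero_of_thinCombDvdRat_zero` (embed `F ↦ C F`, constant in the outer variable). [cite: Washington1997, §7.1–§7.2] -/
theorem eq_zero_of_torsionCombDvdRat (hmax : IsLocalRing.maximalIdeal 𝒪 = Ideal.span {(p : 𝒪)})
    {F : PowerSeries 𝒪} (h : TorsionCombDvdRat 𝒪 p F) : F = 0 := by
  have key : ThinCombDvdRat 𝒪 p 0 (PowerSeries.C F) := by
    intro n
    obtain ⟨m, hnm, t, q, hq⟩ := h n
    refine ⟨m, hnm, t, ?_⟩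
    rw [Ideal.mem_span_pair]
    refine ⟨0, PowerSeries.C q, ?_⟩
    rw [zero_mul, zero_add, combElt, const, RingHom.comp_apply, ← map_mul, ← map_mul, hq, mul_comm]
  have hCF : (PowerSeries.C F : PowerSeries (PowerSeries 𝒪)) = 0 :=
    eq_zero_of_thinCombDvdRat_zero 𝒪 p hmax key
  have := congrArg PowerSeries.constantCoeff hCF
  simpa using this

/-- **Equality from congruence at the torsion points**: two series congruent modulo `E_m(X)` up to a `p`-power slack on
levels of unbounded order are equal — the form in which a reciprocity law proved at all weight-two points of
`p`-power conductor becomes a `Λ`-adic identity. [cite: Washington1997, §7.1–§7.2] -/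
theorem eq_of_torsionCombDvdRat_sub (hmax : IsLocalRing.maximalIdeal 𝒪 = Ideal.span {(p : 𝒪)})
    {F G : PowerSeries 𝒪} (h : TorsionCombDvdRat 𝒪 p (F - G)) : F = G :=
  sub_eq_zero.mp (eq_zero_of_torsionCombDvdRat 𝒪 p hmax h)

/-- The slack-free special case: exact divisibility `E_m ∣ F − G` on unboundedly many levels. [cite: Washington1997, §7.1] -/
theorem eq_of_combSeries_dvd_sub (hmax : IsLocalRing.maximalIdeal 𝒪 = Ideal.span {(p : 𝒪)})
    {F G : PowerSeries 𝒪} (h : ∀ n : ℕ, ∃ m : ℕ, n ≤ m ∧ combSeries 𝒪 p m ∣ F - G) : F = G := by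
  refine eq_of_torsionCombDvdRat_sub 𝒪 p hmax fun n => ?_
  obtain ⟨m, hnm, hdvd⟩ := h n
  exact ⟨m, hnm, 0, by simpa using hdvd⟩

/-! ## §3 Instances: `ℤ_p` and `R₀ = unrIntegers p` -/

/-- `ℤ_p` instance of the density lemma. [cite: Washington1997, §7.1–§7.2] -/
theorem eq_of_torsionCombDvdRat_sub_padicInt {F G : PowerSeries ℤ_[p]} (h : TorsionCombDvdRat ℤ_[p] p (F - G)) :
    F = G :=
  eq_of_torsionCombDvdRat_sub ℤ_[p] p PadicInt.maximalIdeal_eq_span_p h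

/-- `R₀ = unrIntegers p` instance of the density lemma (coefficient ring of the wall's receptacle `UnrSeries p`).
[cite: Washington1997, §7.1–§7.2] -/
theorem eq_of_torsionCombDvdRat_sub_unrIntegers
    {F G : PowerSeries (Literature.NumberTheory.EllipticCurves.unrIntegers p)}
    (h : TorsionCombDvdRat (Literature.NumberTheory.EllipticCurves.unrIntegers p) p (F - G)) : F = G := by
  haveI := Summit.BirchSwinnertonDyer.Rank1Residual.X2.HidaLimitAlgebra.isDiscreteValuationRing_unrIntegers (p := p)
  exact eq_of_torsionCombDvdRat_sub _ p
    ((IsDiscreteValuationRing.irreducible_iff_uniformizer _).mp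
      Summit.BirchSwinnertonDyer.Rank1Residual.X2.HidaLimitAlgebra.irreducible_natCast_p) h

end Summit.BirchSwinnertonDyer.BirchSwinnertonDyer.Cruxes.AdditiveSplitIMCInclusionAtThree.StableFibreRegulator

end
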